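import Mathlib.AlgebraicGeometry.Morphisms.LocalFlatDescent
import Literature.AlgebraicGeometry.Limits.RelativeDimensionDescent
import Literature.AlgebraicGeometry.Motives.BaseChange
import HarnessLib

/-!
# «Smooth of relative dimension `n`» for a `k`-scheme is read off after ANY field extension

Topic `AlgebraicGeometry/Limits`, namespace `Literature.AlgebraicGeometry.Limits`.  THEOREMS ONLY (two), over the tree's
★ `Limits/RelativeDimensionDescent` (pullback-square form, needs `Smooth` downstairs) and Mathlib's fpqc descent of
`Smooth` (`DescendsAlong @Smooth (@Surjective ⊓ @Flat ⊓ @QuasiCompact)`, `Mathlib.AlgebraicGeometry.Morphisms.LocalFlatDescent`).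

For a homomorphism of fields `σ : k →+* L` and a `k`-scheme `X₀` (`Motives.SchemeOver k`), with base change
`X₀ ⊗_σ L := (Motives.baseChangeHom σ).obj X₀`:
* `smooth_hom_of_baseChangeHom_obj` — `X₀ ⊗_σ L → Spec L` smooth ⟹ `X₀ → Spec k` smooth;
* `smoothOfRelativeDimension_hom_of_baseChangeHom_obj` — `X₀ ⊗_σ L → Spec L` smooth of relative dimension `n`
  ⟹ `X₀ → Spec k` smooth of relative dimension `n`.
Both are [EGAIV4] Prop. 17.7.4 (smoothness and its relative dimension descend along a faithfully flat quasi-compact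
base change; `Spec L → Spec k` is one) = [StacksProject] Tag 02VL; the converse direction (base change) is Mathlib's
`smoothOfRelativeDimension_isStableUnderBaseChange`.  The tree had the MORPHISM form (★ `Motives/BaseChangeHomDescent
.smooth_of_baseChangeHom_map`) and the form with `[Smooth X₀.hom]` as a hypothesis (★ `HodgeTheory/AlgebraicCyclesDefinedOverQbarSpread
.smoothOfRelativeDimension_hom_of_baseChangeHom`); this file removes that hypothesis for the structure morphism, which is the
shape needed when a SCHEME over a number field is produced by Galois descent from `ℂ` and its smoothness of relative
dimension `d` is known only for the complex fibre (cell `hodgecm-mathlib`, road (ii) R2-5; canonical models of Shimura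
curves/surfaces).

## References
* [EGAIV4] A. Grothendieck, J. Dieudonné, *ÉGA IV₄* (Publ. Math. IHÉS 32, 1967), Prop. 17.7.4.
* [StacksProject] The Stacks Project, Tag 02VL (descending smoothness along fpqc covers).
* [Hartshorne1977] R. Hartshorne, *Algebraic Geometry*, Ch. III Prop. 10.1 (b) (base extension preserves smooth of rel. dim. `n`).
-/

noncomputable section

open CategoryTheory CategoryTheory.Limits AlgebraicGeometry

set_option backward.isDefEq.respectTransparency false

universe u

namespace Literature.AlgebraicGeometry.Limits

open Literature.AlgebraicGeometry.Motives

variable {k L : Type u} [Field k] [Field L] (σ : k →+* L)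

/-- `Spec L → Spec k` is surjective for a homomorphism of fields `σ : k →+* L` (both spectra are points). [folklore] -/
private theorem surjective_specMap_ofHom : Surjective (Spec.map (CommRingCat.ofHom σ)) := by
  haveI : Subsingleton ↥(Spec (CommRingCat.of k)) :=
    inferInstanceAs (Subsingleton (PrimeSpectrum k))
  exact ⟨fun x ↦ ⟨(default : ↥(Spec (CommRingCat.of L))), Subsingleton.elim _ _⟩⟩

/-- `Spec L → Spec k` is flat for a homomorphism of fields (`L` is a flat = free `k`-module). [folklore] -/
private theorem flat_specMap_ofHom : Flat (Spec.map (CommRingCat.ofHom σ)) := by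
  letI := σ.toAlgebra
  rw [HasRingHomProperty.Spec_iff (P := @Flat)]
  change Module.Flat k L
  infer_instance

/-- **Smoothness of a `k`-scheme descends along any field extension** ([EGAIV4] Prop. 17.7.4 / [StacksProject] Tag 02VL,
through Mathlib's `DescendsAlong @Smooth (@Surjective ⊓ @Flat ⊓ @QuasiCompact)` applied to the cartesian square
`X₀ ⊗_σ L → X₀` over `Spec L → Spec k`): if `X₀ ⊗_σ L → Spec L` is smooth, so is `X₀ → Spec k`.
[cite: EGAIV4, Prop. 17.7.4] [cite: StacksProject, Tag 02VL] -/
theorem smooth_hom_of_baseChangeHom_obj (X₀ : SchemeOver k) [h : Smooth ((baseChangeHom σ).obj X₀).hom] :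
    Smooth X₀.hom := by
  have hsq : IsPullback (baseChangeHomFst σ X₀) ((baseChangeHom σ).obj X₀).hom X₀.hom
      (Spec.map (CommRingCat.ofHom σ)) :=
    IsPullback.of_hasPullback X₀.hom (Spec.map (CommRingCat.ofHom σ))
  haveI h1 := surjective_specMap_ofHom σ
  haveI h2 := flat_specMap_ofHom σ
  have h3 : QuasiCompact (Spec.map (CommRingCat.ofHom σ)) := inferInstance
  have hQ : (@Surjective ⊓ @Flat ⊓ @QuasiCompact : MorphismProperty Scheme.{u})
      (Spec.map (CommRingCat.ofHom σ)) := ⟨⟨h1, h2⟩, h3⟩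
  exact MorphismProperty.of_isPullback_of_descendsAlong (P := @Smooth)
    (Q := @Surjective ⊓ @Flat ⊓ @QuasiCompact) hsq.flip hQ h

/-- **«Smooth of relative dimension `n`» descends along any field extension** ([EGAIV4] Prop. 17.7.4; [Hartshorne1977] III
Prop. 10.1 (b) for the base-extension direction): if `X₀ ⊗_σ L → Spec L` is smooth of relative dimension `n`, then
`X₀ → Spec k` is smooth of relative dimension `n` — `Smooth` descends by `smooth_hom_of_baseChangeHom_obj`, and the relative
dimension is read off upstairs by the tree's ★ `smoothOfRelativeDimension_of_isPullback_of_surjective` (the projection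
`X₀ ⊗_σ L → X₀` is a base change of the surjective `Spec L → Spec k`).
[cite: EGAIV4, Prop. 17.7.4] [cite: StacksProject, Tag 02VL] [cite: Hartshorne1977, Ch. III Prop. 10.1 (b)] -/
theorem smoothOfRelativeDimension_hom_of_baseChangeHom_obj (n : ℕ) (X₀ : SchemeOver k)
    [SmoothOfRelativeDimension n ((baseChangeHom σ).obj X₀).hom] :
    SmoothOfRelativeDimension n X₀.hom := by
  have hsq : IsPullback (baseChangeHomFst σ X₀) ((baseChangeHom σ).obj X₀).hom X₀.hom
      (Spec.map (CommRingCat.ofHom σ)) :=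
    IsPullback.of_hasPullback X₀.hom (Spec.map (CommRingCat.ofHom σ))
  haveI : Smooth ((baseChangeHom σ).obj X₀).hom := SmoothOfRelativeDimension.smooth n _
  haveI : Smooth X₀.hom := smooth_hom_of_baseChangeHom_obj σ X₀
  haveI := surjective_specMap_ofHom σ
  exact smoothOfRelativeDimension_of_isPullback_of_surjective hsq n

end Literature.AlgebraicGeometry.Limits

end
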